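import Literature.Topology.Immersions.NormalThickening
import Literature.Geometry.Manifold.InjOnNhdsOfCompact
import Literature.Topology.FourManifolds.ImmersionCriterion
import HarnessLib

/-!
# Sections of the transversal thickening of a compact embedded hypersurface are embeddings

Topic `Literature/Topology/Immersions`; continuation of `NormalThickening.lean`.  For a `C^n`
(`n ≥ 1`) INJECTIVE immersion `f : V → F'` of a COMPACT boundaryless manifold (an embedded
closed hypersurface, `dim F' = dim V + 1`) and a `C^n` transversal field `ν` along it, the
thickening `Θ(v, s) = f(v) + s ν(v)` is not only a local diffeomorphism near the zero section
(`exists_pos_forall_isLocalDiffeomorphAt_thickening`) but INJECTIVE on a uniform tube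
`V × (-ε, ε)` (Hirsch, *Differential Topology* (1976), Ch. 4 §5, proof of Thm. 5.1: an immersion
injective on a compact set is injective on a neighbourhood of it; here through the tree's
`Literature.Geometry.Manifold.exists_isOpen_injOn_of_isCompact` and the tube lemma), so that it is
a tubular neighbourhood map of the hypersurface.  Consequently every SECTION of the tube, i.e.
every map `v ↦ f(v) + τ(v) ν(v)` with `τ : V → ℝ` of class `C^n` and `|τ| < ε`, is again a `C^n`
embedding `V ↪ F'` — whatever the size of `dτ`.  This is the elementary mechanism behind pushing
an embedded hypersurface along a transversal field by a `C⁰`-small but `C¹`-large amount, e.g.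
the maps `I^τ_S(z) = v^{τ(z)}(z)` of Eliashberg–Mishachev's goffering (*Wrinkled embeddings*
(2009), §2.7) in the flat model where the flow of `v` is `z ↦ z + t v`.

* `injOn_of_isLocalDiffeomorphAt` — a local diffeomorphism at `x` is injective near `x`;
* `exists_pos_injOn_thickening` — **uniform tube**: `Θ` is injective on `V × (-ε, ε)` and has
  injective differential there;
* `isSmoothEmbedding_thickening_section` — **sections of the tube are embeddings**: for `C^n`
  `τ : V → ℝ` with `|τ v| < ε` for all `v`, `v ↦ f v + τ v • ν v` is a `C^n` embedding
  (`Manifold.IsSmoothEmbedding`), with injective differential, within `C⁰`-distance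
  `|τ v| ‖ν v‖` of `f`.

Everything is proved; theorems only, no definitions, no named facts.

## References

* M. W. Hirsch, *Differential Topology*, GTM 33 (1976), Ch. 4 §5 (tubular neighbourhoods; proof
  of Thm. 5.1) and Ch. 2 §1 Ex. 7. [HirschDT1976]
* Y. Eliashberg, N. Mishachev, *Wrinkled embeddings*, Contemp. Math. **498** (2009), §2.7 (the
  perturbations `I^τ_S`). [EliashbergMishachev2009]
-/

noncomputable section

open Set Function Filter Metric
open scoped Manifold ContDiff Topology

namespace Literature.Topology.Immersions

variable {E : Type*} [NormedAddCommGroup E] [NormedSpace ℝ E]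
  {H : Type*} [TopologicalSpace H] {I : ModelWithCorners ℝ E H}
  {V : Type*} [TopologicalSpace V] [ChartedSpace H V]
  {F' : Type*} [NormedAddCommGroup F'] [NormedSpace ℝ F']
  {n : WithTop ℕ∞}

/-- A `C^n` local diffeomorphism at `x` is injective on some neighbourhood of `x` (it agrees with
a partial diffeomorphism on the source of the latter). [folklore] -/
theorem injOn_of_isLocalDiffeomorphAt {N : Type*} [TopologicalSpace N] {H' : Type*}
    [TopologicalSpace H'] {E'' : Type*} [NormedAddCommGroup E''] [NormedSpace ℝ E'']
    {J : ModelWithCorners ℝ E'' H'} [ChartedSpace H' N] {g : V → N} {x : V}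
    (hg : IsLocalDiffeomorphAt I J n g x) : ∃ U ∈ 𝓝 x, InjOn g U := by
  obtain ⟨Φ, hx, heq⟩ := hg
  refine ⟨Φ.source, Φ.open_source.mem_nhds hx, fun a ha b hb hab => ?_⟩
  have hab' : Φ a = Φ b := by rw [← heq ha, ← heq hb]; exact hab
  exact Φ.toPartialEquiv.injOn ha hb hab'

/-- **Uniform tube of an embedded compact hypersurface with a transversal field** (Hirsch Ch. 4
§5): for `V` compact boundaryless over a finite-dimensional model, `dim F' = dim E + 1`,
`f, ν : V → F'` of class `C^n` (`n ≥ 1`) with `f` INJECTIVE, every `df_v` injective and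
`ν(v) ∉ im df_v`, there is `ε > 0` such that `Θ(v, s) = f(v) + s ν(v)` is injective on the tube
`V × (-ε, ε)` and has injective differential at each of its points.
[cite: HirschDT1976, Ch. 4 §5 Thm. 5.1 (proof)] -/
theorem exists_pos_injOn_thickening [I.Boundaryless] [IsManifold I n V] [FiniteDimensional ℝ E]
    [FiniteDimensional ℝ F'] [CompactSpace V] [T2Space V] {f ν : V → F'}
    (hf : ContMDiff I 𝓘(ℝ, F') n f) (hν : ContMDiff I 𝓘(ℝ, F') n ν) (hn : 1 ≤ n)
    (hinj : Injective f) (hfi : ∀ v, Injective (mfderiv I 𝓘(ℝ, F') f v))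
    (hνt : ∀ (v : V) (w : TangentSpace I v), mfderiv I 𝓘(ℝ, F') f v w ≠ ν v)
    (hdim : Module.finrank ℝ F' = Module.finrank ℝ E + 1) :
    ∃ ε > 0, InjOn (fun q : V × ℝ => f q.1 + q.2 • ν q.1) (univ ×ˢ Ioo (-ε) ε) ∧
      ∀ q : V × ℝ, |q.2| < ε →
        Injective (mfderiv (I.prod 𝓘(ℝ, ℝ)) 𝓘(ℝ, F') (fun q : V × ℝ => f q.1 + q.2 • ν q.1) q) := by
  set Θ : V × ℝ → F' := fun q => f q.1 + q.2 • ν q.1 with hΘ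
  obtain ⟨ε₁, hε₁, hld⟩ :=
    exists_pos_forall_isLocalDiffeomorphAt_thickening hf hν hn hfi hνt hdim
  obtain ⟨ε₂, hε₂, hdinj⟩ := exists_pos_forall_injective_mfderiv_thickening hf hν hn hfi hνt
  -- injectivity on an open neighbourhood of the zero section
  have hK : IsCompact ((univ : Set V) ×ˢ ({0} : Set ℝ)) := isCompact_univ.prod isCompact_singleton
  have hcont : Continuous Θ := (contMDiff_thickening hf hν).continuous
  have hinjK : InjOn Θ ((univ : Set V) ×ˢ ({0} : Set ℝ)) := by
    rintro ⟨v, s⟩ ⟨-, hs⟩ ⟨v', s'⟩ ⟨-, hs'⟩ h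
    rw [mem_singleton_iff] at hs hs'
    subst hs hs'
    have h' : f v = f v' := by simpa [hΘ] using h
    rw [hinj h']
  have hloc : ∀ q ∈ (univ : Set V) ×ˢ ({0} : Set ℝ), ∃ U ∈ 𝓝 q, InjOn Θ U := by
    rintro ⟨v, s⟩ ⟨-, hs⟩
    rw [mem_singleton_iff] at hs
    subst hs
    exact injOn_of_isLocalDiffeomorphAt (hld (v, 0) (by simpa using hε₁))
  obtain ⟨O, hOo, hKO, hinjO⟩ :=
    Literature.Geometry.Manifold.exists_isOpen_injOn_of_isCompact hK hcont hinjK hloc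
  -- a uniform tube inside `O`
  obtain ⟨u, w, -, hwo, huniv, h0w, huw⟩ :=
    generalized_tube_lemma isCompact_univ isCompact_singleton hOo hKO
  obtain ⟨ε₃, hε₃, hε₃w⟩ := Metric.isOpen_iff.mp hwo 0 (h0w (mem_singleton 0))
  refine ⟨min ε₂ ε₃, lt_min hε₂ hε₃, ?_, fun q hq => hdinj q (lt_of_lt_of_le hq (min_le_left _ _))⟩
  rintro ⟨v, s⟩ ⟨-, hs⟩ ⟨v', s'⟩ ⟨-, hs'⟩ h
  have hsub : ∀ t ∈ Ioo (-(min ε₂ ε₃)) (min ε₂ ε₃), t ∈ w := fun t ht => by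
    refine hε₃w ?_
    rw [Metric.mem_ball, Real.dist_eq, sub_zero, abs_lt]
    exact ⟨lt_of_le_of_lt (neg_le_neg (min_le_right _ _)) ht.1,
      lt_of_lt_of_le ht.2 (min_le_right _ _)⟩
  exact hinjO (huw ⟨huniv (mem_univ v), hsub s hs⟩) (huw ⟨huniv (mem_univ v'), hsub s' hs'⟩) h

/-- **Sections of the tube are embeddings.**  In the situation of `exists_pos_injOn_thickening`
there is `ε > 0` such that for EVERY `C^n` function `τ : V → ℝ` with `|τ v| < ε` for all `v`, the
pushed map `v ↦ f v + τ v • ν v` is a `C^n` embedding with everywhere injective differential —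
however large `dτ` is.  (It is `Θ ∘ (id, τ)`: injective because `Θ` is injective on the tube,
immersive by the chain rule since `d(id, τ)` and `dΘ` are injective; an injective immersion of a
compact manifold is an embedding.)  Its `C⁰`-distance to `f` at `v` is `|τ v| ‖ν v‖`.
[cite: HirschDT1976, Ch. 4 §5; EliashbergMishachev2009, §2.7] -/
theorem isSmoothEmbedding_thickening_section [I.Boundaryless] [IsManifold I n V]
    [FiniteDimensional ℝ E] [FiniteDimensional ℝ F'] [CompactSpace V] [T2Space V] {f ν : V → F'}
    (hf : ContMDiff I 𝓘(ℝ, F') n f) (hν : ContMDiff I 𝓘(ℝ, F') n ν) (hn : 1 ≤ n)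
    (hinj : Injective f) (hfi : ∀ v, Injective (mfderiv I 𝓘(ℝ, F') f v))
    (hνt : ∀ (v : V) (w : TangentSpace I v), mfderiv I 𝓘(ℝ, F') f v w ≠ ν v)
    (hdim : Module.finrank ℝ F' = Module.finrank ℝ E + 1) :
    ∃ ε > 0, ∀ τ : V → ℝ, ContMDiff I 𝓘(ℝ, ℝ) n τ → (∀ v, |τ v| < ε) →
      Manifold.IsSmoothEmbedding I 𝓘(ℝ, F') n (fun v => f v + τ v • ν v) ∧
      (∀ v, Injective (mfderiv I 𝓘(ℝ, F') (fun v => f v + τ v • ν v) v)) ∧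
      ∀ v, dist (f v + τ v • ν v) (f v) = |τ v| * ‖ν v‖ := by
  obtain ⟨ε, hε, hinjΘ, hdΘ⟩ := exists_pos_injOn_thickening hf hν hn hinj hfi hνt hdim
  refine ⟨ε, hε, fun τ hτ hτε => ?_⟩
  have hn0 : n ≠ 0 := by
    rintro rfl
    exact not_lt.2 hn zero_lt_one
  set Θ : V × ℝ → F' := fun q => f q.1 + q.2 • ν q.1 with hΘ
  set g : V → V × ℝ := fun v => (v, τ v) with hg
  have hgs : ContMDiff I (I.prod 𝓘(ℝ, ℝ)) n g := contMDiff_id.prodMk hτ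
  have hcomp : (fun v => f v + τ v • ν v) = Θ ∘ g := rfl
  have hsm : ContMDiff I 𝓘(ℝ, F') n (fun v => f v + τ v • ν v) := by
    rw [hcomp]
    exact (contMDiff_thickening hf hν).comp hgs
  -- injectivity
  have hinj' : Injective (fun v => f v + τ v • ν v) := by
    intro v v' h
    have hv : g v ∈ (univ : Set V) ×ˢ Ioo (-ε) ε := ⟨mem_univ _, abs_lt.1 (hτε v)⟩
    have hv' : g v' ∈ (univ : Set V) ×ˢ Ioo (-ε) ε := ⟨mem_univ _, abs_lt.1 (hτε v')⟩
    have := hinjΘ hv hv' h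
    exact congrArg Prod.fst this
  -- injectivity of the differential (chain rule)
  have hd : ∀ v, Injective (mfderiv I 𝓘(ℝ, F') (fun v => f v + τ v • ν v) v) := by
    intro v
    have hgd : HasMFDerivAt I (I.prod 𝓘(ℝ, ℝ)) g v
        ((ContinuousLinearMap.id ℝ (TangentSpace I v)).prod (mfderiv I 𝓘(ℝ, ℝ) τ v)) :=
      (hasMFDerivAt_id (I := I) v).prodMk ((hτ v).mdifferentiableAt hn0).hasMFDerivAt
    have hΘd : HasMFDerivAt (I.prod 𝓘(ℝ, ℝ)) 𝓘(ℝ, F') Θ (g v)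
        (mfderiv (I.prod 𝓘(ℝ, ℝ)) 𝓘(ℝ, F') Θ (g v)) :=
      ((contMDiff_thickening hf hν (I := I)) (g v)).mdifferentiableAt hn0 |>.hasMFDerivAt
    have hc := hΘd.comp v hgd
    rw [← hcomp] at hc
    rw [hc.mfderiv]
    refine (hdΘ (g v) (hτε v)).comp ?_
    intro a b hab
    have h1 : ((ContinuousLinearMap.id ℝ (TangentSpace I v)).prod (mfderiv I 𝓘(ℝ, ℝ) τ v) a).1 =
        ((ContinuousLinearMap.id ℝ (TangentSpace I v)).prod (mfderiv I 𝓘(ℝ, ℝ) τ v) b).1 :=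
      congrArg Prod.fst hab
    exact h1
  refine ⟨Literature.Topology.FourManifolds.isSmoothEmbedding_of_injective_of_injective_mfderiv
    hsm hn hinj' hd, hd, fun v => ?_⟩
  rw [dist_eq_norm, add_sub_cancel_left, norm_smul, Real.norm_eq_abs]

end Literature.Topology.Immersions

end
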